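import Literature.Computability.AlgebraicComplexity.BILPS19MinrankVarieties
import HarnessLib

/-!
# The Latin-rectangle condition `LRC(α, β)` of BILPS 2019 for `α ≤ 2`, and its failure for odd `β`

Bläser–Ikenmeyer–Lysikov–Pandey–Schreyer 2019, §7.3 (held text `paper:arxiv-1911.02534`
p0026:L8–33) state the Latin Rectangle Conjecture `LRC(α, β)` "for every `α ∈ ℕ` and every even
`β ∈ ℕ` such that `α ≤ β`" (Conjecture 26: for generic `𝒰 = {u_1, …, u_β} ⊂ ℂ^α`, `∑_L det(L) ≠ 0`
over all `α × β` Latin rectangles `L` for `𝒰`), and record (p0026:L28–29): "`LRC(1, β)` is trivially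
true for all `β`. The fact that `LRC(2, β)` is true for all even `β` follows from the classical proof of
Hermite's reciprocity theorem". `LRC(k, m)` is the HYPOTHESIS of their Thm. 27 (tree:
`BILPS2019_thm27`, with `latinRectangleCondition k m := latinRectSumPoly k m ≠ 0`, the sum
`∑_L det(L)` as an integer polynomial in the coordinates `X_{(v,a)}` of the `u_v`).

This theorem-only file makes the typed hypothesis honest in the two printed cases and pins down the
parity restriction:

* `latinRectangleCondition_one` — `LRC(1, β)` for every `β` (every `1 × β` Latin rectangle contributes
  the same monomial `∏_v X_{(v,0)}`; evaluate at `X ≡ 1`).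
* `latinRectSumPoly_eq_zero_of_odd` — for `α ≥ 2` and ODD `β` the polynomial `∑_L det(L)` is
  identically `0`: exchanging two rows is a fixed-point-free involution on Latin rectangles that
  multiplies every column determinant by `-1`, hence `det(L)` by `(-1)^β = -1`
  (`not_latinRectangleCondition_of_odd`). So the conjecture's restriction to even `β` is forced.
* `latinRectangleCondition_two_iff` — **`LRC(2, β) ↔ β` even.** For `β = h + h` evaluate at the
  balanced configuration `u_v = e₁ (v < h)`, `u_v = e₂ (v ≥ h)`: a column determinant
  `det(u_{L_{1j}}, u_{L_{2j}})` is `0` unless the column is bichromatic, and then equals `+1` or `-1`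
  according as `L_{1j} < h` or not; for a Latin rectangle with all columns bichromatic the product of
  these signs is `∏_v s(v)` re-indexed along the bijective first row — a fixed unit `c` — so the
  evaluation is `c · #{bichromatic Latin rectangles} ≠ 0` (the rectangle with rows `id` and the
  half-swap is one). This is an elementary substitute for the Hermite-reciprocity argument cited in
  the source (not the printed proof).

No definitions, no named facts; nothing here bears on `VP ≠ VNP` (hygiene of a typed hypothesis of
row X5-BILPS19).

## References
* [BlaserIkenmeyerLysikovPandeySchreyer2019] M. Bläser, C. Ikenmeyer, V. Lysikov, A. Pandey,
  F.-O. Schreyer, *Variety membership testing, algebraic natural proofs, and geometric complexity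
  theory*, arXiv:1911.02534, §7.3, Conjecture 26 and the remarks after it (p0026:L21–33).
* [Kumar2015] S. Kumar, *A study of the representations supported by the orbit closure of the
  determinant*, Compositio Math. 151 (2015), Def. 4.1 (Latin rectangles; tree `Kumar2015.IsLatinRect`).
-/

noncomputable section

open MvPolynomial Finset

namespace Literature.Computability.AlgebraicComplexity

namespace BILPS2019

/-! ## Evaluating the column-determinant polynomial -/

/-- Evaluation of a column-determinant product: `eval v (det L) = ∏_j det (v ∘ labels of column j)`.
[cite: BlaserIkenmeyerLysikovPandeySchreyer2019, §7.3 (column-determinant)] -/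
theorem eval_colDetPoly {α β : ℕ} (v : Fin β × Fin α → ℤ) (R : Fin α → Fin β → Fin β) :
    eval v (colDetPoly R) =
      ∏ j : Fin β, Matrix.det (Matrix.of fun a p : Fin α => v (R p j, a)) := by
  unfold colDetPoly
  rw [map_prod]
  refine Finset.prod_congr rfl fun j _ => ?_
  rw [RingHom.map_det]
  congr 1
  ext a p
  simp [RingHom.mapMatrix_apply, Matrix.map_apply]

/-- Evaluation of `∑_L det(L)`. [cite: BlaserIkenmeyerLysikovPandeySchreyer2019, §7.3] -/
theorem eval_latinRectSumPoly {α β : ℕ} (v : Fin β × Fin α → ℤ) :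
    eval v (latinRectSumPoly α β) =
      ∑ R ∈ @Finset.filter _ (fun R : Fin α → Fin β → Fin β => Kumar2015.IsLatinRect R)
          (Classical.decPred _) Finset.univ,
        ∏ j : Fin β, Matrix.det (Matrix.of fun a p : Fin α => v (R p j, a)) := by
  unfold latinRectSumPoly
  rw [map_sum]
  exact Finset.sum_congr rfl fun R _ => eval_colDetPoly v R

/-! ## `LRC(1, β)` -/

/-- **`LRC(1, β)` holds for every `β`** ("trivially true for all `β`", p0026:L28): at `X ≡ 1` every
`1 × β` Latin rectangle (= a permutation) contributes `1`, and the identity is one of them.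
[cite: BlaserIkenmeyerLysikovPandeySchreyer2019, §7.3 (after Conjecture 26)] -/
theorem latinRectangleCondition_one (β : ℕ) : latinRectangleCondition 1 β := by
  classical
  intro h0
  have h := congrArg (eval fun _ : Fin β × Fin 1 => (1 : ℤ)) h0
  rw [eval_latinRectSumPoly, map_zero] at h
  simp only [Matrix.det_unique, Matrix.of_apply, Finset.prod_const_one, Finset.sum_const,
    nsmul_eq_mul, mul_one, Nat.cast_eq_zero, Finset.card_eq_zero] at h
  have hmem : (fun (_ : Fin 1) (j : Fin β) => j) ∈
      @Finset.filter _ (fun R : Fin 1 → Fin β → Fin β => Kumar2015.IsLatinRect R)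
        (Classical.decPred _) Finset.univ := by
    rw [Finset.mem_filter]
    exact ⟨Finset.mem_univ _, fun _ => Function.bijective_id, fun _ _ _ _ => Subsingleton.elim _ _⟩
  rw [h] at hmem
  exact Finset.notMem_empty _ hmem

/-! ## Odd `β`: exchanging two rows kills `∑_L det(L)` -/

/-- Exchanging rows along a permutation `σ` of the row indices multiplies the column-determinant
product by `sign(σ)^β`. [cite: BlaserIkenmeyerLysikovPandeySchreyer2019, §7.3 (column-determinant)] -/
theorem colDetPoly_comp_perm {α β : ℕ} (R : Fin α → Fin β → Fin β) (σ : Equiv.Perm (Fin α)) :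
    colDetPoly (fun p j => R (σ p) j) =
      ((Equiv.Perm.sign σ : ℤˣ) : MvPolynomial (Fin β × Fin α) ℤ) ^ β * colDetPoly R := by
  unfold colDetPoly
  have h : ∀ j : Fin β,
      Matrix.det (Matrix.of fun a p : Fin α => (X (R (σ p) j, a) : MvPolynomial (Fin β × Fin α) ℤ)) =
        ((Equiv.Perm.sign σ : ℤˣ) : MvPolynomial (Fin β × Fin α) ℤ) *
          Matrix.det (Matrix.of fun a p : Fin α => (X (R p j, a) : MvPolynomial (Fin β × Fin α) ℤ)) := by
    intro j
    rw [← Matrix.det_permute']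
    rfl
  simp_rw [h]
  rw [Finset.prod_mul_distrib, Finset.prod_const, Finset.card_univ, Fintype.card_fin]

/-- Exchanging rows along a permutation of the row indices preserves Latin rectangles.
[cite: Kumar2015, Def. 4.1] -/
theorem isLatinRect_comp_perm {α β : ℕ} {R : Fin α → Fin β → Fin β} (hR : Kumar2015.IsLatinRect R)
    (σ : Equiv.Perm (Fin α)) : Kumar2015.IsLatinRect fun p j => R (σ p) j :=
  ⟨fun p => hR.1 (σ p), fun j => (hR.2 j).comp σ.injective⟩

/-- **For `α ≥ 2` and odd `β`, `∑_L det(L) = 0` identically**: the exchange of the first two rows is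
a fixed-point-free involution on `α × β` Latin rectangles reversing the sign of `det(L)`. (So the
Latin Rectangle Conjecture is stated for even `β` only, p0026:L21.)
[cite: BlaserIkenmeyerLysikovPandeySchreyer2019, §7.3, Conjecture 26 (parity restriction)] -/
theorem latinRectSumPoly_eq_zero_of_odd {α β : ℕ} (hα : 2 ≤ α) (hβ : Odd β) :
    latinRectSumPoly α β = 0 := by
  classical
  set p₀ : Fin α := ⟨0, by omega⟩ with hp₀
  set p₁ : Fin α := ⟨1, by omega⟩ with hp₁
  have hne : p₀ ≠ p₁ := by simp [hp₀, hp₁, Fin.ext_iff]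
  set σ : Equiv.Perm (Fin α) := Equiv.swap p₀ p₁ with hσ
  have hsign : ((Equiv.Perm.sign σ : ℤˣ) : MvPolynomial (Fin β × Fin α) ℤ) ^ β = -1 := by
    rw [hσ, Equiv.Perm.sign_swap hne]
    simp only [Units.val_neg, Units.val_one, Int.cast_neg, Int.cast_one]
    exact hβ.neg_one_pow
  unfold latinRectSumPoly
  refine Finset.sum_involution (fun R _ => fun p j => R (σ p) j) ?_ ?_ ?_ ?_
  · intro R _
    rw [colDetPoly_comp_perm, hsign]; ring
  · intro R hR _ hfix
    rw [Finset.mem_filter] at hR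
    obtain ⟨j⟩ : Nonempty (Fin β) := ⟨⟨0, hβ.pos⟩⟩
    have h1 : R (σ p₀) j = R p₀ j := by
      have := congrFun (congrFun hfix p₀) j; exact this
    rw [hσ, Equiv.swap_apply_left] at h1
    exact hne ((hR.2.2 j) h1.symm)
  · intro R hR
    rw [Finset.mem_filter] at hR ⊢
    exact ⟨Finset.mem_univ _, isLatinRect_comp_perm hR.2 σ⟩
  · intro R _
    funext p j
    simp [hσ, Equiv.swap_apply_self]

/-- **`LRC(α, β)` fails for `α ≥ 2` and odd `β`.**
[cite: BlaserIkenmeyerLysikovPandeySchreyer2019, §7.3, Conjecture 26 (parity restriction)] -/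
theorem not_latinRectangleCondition_of_odd {α β : ℕ} (hα : 2 ≤ α) (hβ : Odd β) :
    ¬ latinRectangleCondition α β :=
  fun h => h (latinRectSumPoly_eq_zero_of_odd hα hβ)

/-! ## `LRC(2, β)` for even `β`: the balanced evaluation -/

section Two

variable (h : ℕ)

/-- The balanced configuration: `u_v = e₁` for `v < h`, `u_v = e₂` for `v ≥ h` (coordinates
`X_{(v,a)} ↦ [v < h ↔ a = 0]`). [cite: BlaserIkenmeyerLysikovPandeySchreyer2019, §7.3] -/
private def balVal (β : ℕ) (x : Fin β × Fin 2) : ℤ :=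
  if (x.1 : ℕ) < h then (if x.2 = 0 then 1 else 0) else (if x.2 = 0 then 0 else 1)

/-- The sign attached to a label: `+1` on the first half, `-1` on the second. [folklore] -/
private def halfSign (β : ℕ) (v : Fin β) : ℤ := if (v : ℕ) < h then 1 else -1

/-- A column with labels `t` (top) and `b` (bottom) evaluates, at the balanced configuration, to
`halfSign t` when it is bichromatic and to `0` otherwise.
[cite: BlaserIkenmeyerLysikovPandeySchreyer2019, §7.3] -/
private theorem det_balVal {β : ℕ} (t b : Fin β) :
    Matrix.det (Matrix.of fun a p : Fin 2 => balVal h β (![t, b] p, a)) =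
      if ((t : ℕ) < h ↔ ¬ (b : ℕ) < h) then halfSign h β t else 0 := by
  rw [Matrix.det_fin_two]
  simp only [Matrix.of_apply, Matrix.cons_val_zero, Matrix.cons_val_one, balVal, halfSign]
  by_cases ht : (t : ℕ) < h <;> by_cases hb : (b : ℕ) < h <;> simp [ht, hb]

/-- For a `2 × β` array, column `j` read as the pair (top, bottom). [folklore] -/
private theorem of_eq_vec {β : ℕ} (v : Fin β × Fin 2 → ℤ) (R : Fin 2 → Fin β → Fin β) (j : Fin β) :
    (Matrix.of fun a p : Fin 2 => v (R p j, a)) = Matrix.of fun a p : Fin 2 => v (![R 0 j, R 1 j] p, a) := by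
  ext a p
  fin_cases p <;> simp

/-- The evaluation of `det(L)` at the balanced configuration, for a `2 × β` array whose first row
is a bijection: the fixed unit `∏_v halfSign v` if every column is bichromatic, else `0`.
[cite: BlaserIkenmeyerLysikovPandeySchreyer2019, §7.3] -/
private theorem prod_det_balVal {β : ℕ} (R : Fin 2 → Fin β → Fin β) (hR0 : Function.Bijective (R 0)) :
    ∏ j : Fin β, Matrix.det (Matrix.of fun a p : Fin 2 => balVal h β (R p j, a)) =
      if ∀ j, ((R 0 j : ℕ) < h ↔ ¬ (R 1 j : ℕ) < h) then ∏ v : Fin β, halfSign h β v else 0 := by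
  classical
  simp_rw [of_eq_vec (balVal h β) R, det_balVal]
  split_ifs with hgood
  · rw [show (∏ j : Fin β, if ((R 0 j : ℕ) < h ↔ ¬ (R 1 j : ℕ) < h) then halfSign h β (R 0 j) else 0) =
        ∏ j : Fin β, halfSign h β (R 0 j) from Finset.prod_congr rfl fun j _ => if_pos (hgood j)]
    exact hR0.prod_comp (halfSign h β)
  · obtain ⟨j, hj⟩ := not_forall.mp hgood
    exact Finset.prod_eq_zero (Finset.mem_univ j) (if_neg hj)

/-- The fixed unit is nonzero. [folklore] -/
private theorem prod_halfSign_ne_zero (β : ℕ) : ∏ v : Fin β, halfSign h β v ≠ 0 :=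
  Finset.prod_ne_zero_iff.mpr fun v _ => by unfold halfSign; split_ifs <;> norm_num

/-- The half-swap of `Fin (h + h)`: `castAdd i ↔ natAdd i`. [folklore] -/
private def halfSwap : Fin (h + h) ≃ Fin (h + h) :=
  finSumFinEquiv.symm.trans ((Equiv.sumComm (Fin h) (Fin h)).trans finSumFinEquiv)

/-- The half-swap on the first half. [folklore] -/
private theorem halfSwap_castAdd (i : Fin h) : halfSwap h (Fin.castAdd h i) = Fin.natAdd h i := by
  simp only [halfSwap, Equiv.trans_apply, finSumFinEquiv_symm_apply_castAdd, Equiv.sumComm_apply,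
    Sum.swap_inl, finSumFinEquiv_apply_right]

/-- The half-swap on the second half. [folklore] -/
private theorem halfSwap_natAdd (i : Fin h) : halfSwap h (Fin.natAdd h i) = Fin.castAdd h i := by
  simp only [halfSwap, Equiv.trans_apply, finSumFinEquiv_symm_apply_natAdd, Equiv.sumComm_apply,
    Sum.swap_inr, finSumFinEquiv_apply_left]

/-- The half-swap moves every label to the other half. [folklore] -/
private theorem halfSwap_lt_iff (j : Fin (h + h)) : ((halfSwap h j : ℕ) < h ↔ ¬ (j : ℕ) < h) := by
  induction j using Fin.addCases with
  | left i => rw [halfSwap_castAdd]; simp [i.isLt]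
  | right i => rw [halfSwap_natAdd]; simp [i.isLt]

/-- The witness rectangle: rows `id` and the half-swap. [folklore] -/
private def witnessRect : Fin 2 → Fin (h + h) → Fin (h + h) := ![id, halfSwap h]

/-- First row of the witness. [folklore] -/
private theorem witnessRect_zero (j : Fin (h + h)) : witnessRect h 0 j = j := rfl

/-- Second row of the witness. [folklore] -/
private theorem witnessRect_one (j : Fin (h + h)) : witnessRect h 1 j = halfSwap h j := rfl

/-- The witness rectangle is a Latin rectangle with all columns bichromatic. [folklore] -/
private theorem witnessRect_isLatinRect : Kumar2015.IsLatinRect (witnessRect h) := by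
  refine ⟨fun p => ?_, fun j => ?_⟩
  · fin_cases p
    · exact Function.bijective_id
    · exact (halfSwap h).bijective
  · intro p q hpq
    have hj : halfSwap h j ≠ j := by
      intro heq
      have := halfSwap_lt_iff h j
      rw [heq] at this
      exact iff_not_self this
    fin_cases p <;> fin_cases q
    · rfl
    · exact absurd hpq.symm (by simpa [witnessRect] using hj)
    · exact absurd hpq (by simpa [witnessRect] using hj)
    · rfl

/-- Every column of the witness is bichromatic. [folklore] -/
private theorem witnessRect_good (j : Fin (h + h)) :
    ((witnessRect h 0 j : ℕ) < h ↔ ¬ (witnessRect h 1 j : ℕ) < h) := by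
  rw [witnessRect_zero, witnessRect_one, halfSwap_lt_iff, not_not]

/-- **`LRC(2, h + h)`**: the balanced evaluation of `∑_L det(L)` is the nonzero unit `∏_v halfSign v`
times the (positive) number of bichromatic `2 × (h+h)` Latin rectangles.
[cite: BlaserIkenmeyerLysikovPandeySchreyer2019, §7.3 (LRC(2, β), β even)] -/
theorem latinRectangleCondition_two_add_self : latinRectangleCondition 2 (h + h) := by
  classical
  intro h0
  have he := congrArg (eval (balVal h (h + h))) h0
  rw [eval_latinRectSumPoly, map_zero] at he
  -- every Latin rectangle contributes `c` or `0`
  set LR := @Finset.filter _ (fun R : Fin 2 → Fin (h + h) → Fin (h + h) => Kumar2015.IsLatinRect R)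
    (Classical.decPred _) Finset.univ with hLR
  set c : ℤ := ∏ v : Fin (h + h), halfSign h (h + h) v with hc
  have hterm : ∀ R ∈ LR,
      ∏ j : Fin (h + h), Matrix.det (Matrix.of fun a p : Fin 2 => balVal h (h + h) (R p j, a)) =
        if ∀ j, ((R 0 j : ℕ) < h ↔ ¬ (R 1 j : ℕ) < h) then c else 0 := by
    intro R hR
    rw [hLR, Finset.mem_filter] at hR
    exact prod_det_balVal h R (hR.2.1 0)
  rw [Finset.sum_congr rfl hterm, Finset.sum_ite, Finset.sum_const_zero, add_zero, Finset.sum_const,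
    nsmul_eq_mul, mul_eq_zero] at he
  rcases he with hcard | hc0
  · rw [Nat.cast_eq_zero, Finset.card_eq_zero] at hcard
    have hmem : witnessRect h ∈ LR.filter fun R => ∀ j, ((R 0 j : ℕ) < h ↔ ¬ (R 1 j : ℕ) < h) := by
      rw [Finset.mem_filter, hLR, Finset.mem_filter]
      exact ⟨⟨Finset.mem_univ _, witnessRect_isLatinRect h⟩, witnessRect_good h⟩
    rw [hcard] at hmem
    exact Finset.notMem_empty _ hmem
  · exact prod_halfSign_ne_zero h (h + h) hc0

end Two

/-- **`LRC(2, β)` holds exactly for even `β`** ("`LRC(2, β)` is true for all even `β`", p0026:L29 —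
there via Hermite reciprocity, here by the balanced evaluation; odd `β` by the row exchange).
[cite: BlaserIkenmeyerLysikovPandeySchreyer2019, §7.3 (after Conjecture 26)] -/
theorem latinRectangleCondition_two_iff (β : ℕ) : latinRectangleCondition 2 β ↔ Even β := by
  refine ⟨fun hL => ?_, fun ⟨h, hh⟩ => hh ▸ latinRectangleCondition_two_add_self h⟩
  by_contra hodd
  rw [Nat.not_even_iff_odd] at hodd
  exact not_latinRectangleCondition_of_odd le_rfl hodd hL

/-- `LRC(2, β)` for even `β`, in the form the source states. [cite: BlaserIkenmeyerLysikovPandeySchreyer2019, §7.3 (after Conjecture 26)] -/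
theorem latinRectangleCondition_two {β : ℕ} (hβ : Even β) : latinRectangleCondition 2 β :=
  (latinRectangleCondition_two_iff β).2 hβ

end BILPS2019

end Literature.Computability.AlgebraicComplexity

end
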